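import Summits.Ventures.HSemireg.UntwistFullSigma
import Literature.AlgebraicGeometry.Modules.ModulesGrothendieckAbelian
import Mathlib.Algebra.Homology.DerivedCategory.Ext.MapBijective
import HarnessLib

/-!
# Venture HSemireg — untwisting along an autoequivalence of the module category: the `Ext²`
# identification of route R1.0 (i) made real for EQUIVALENCES, and the transport of full semiregularity

HONEST FRAMING. Homological algebra (Mathlib's `Ext`, `Functor.mapExtAddHom`) plus the tree's
`EnoughInjectives X.Modules` (`Modules/ModulesGrothendieckAbelian.lean`), composed with the triangular
transport of `UntwistFullSigma.lean`. Nothing is asserted about any variety; no twist functor and no gerbe is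
constructed; nothing here says HC, HC_CM or HC_AV is proved.

Route R1.0 of the cell's `general-structure/PERRY-SUBSTITUTE-GS.md` (the `μ₂`-gerbe untwisting step) begins
with (i) `Ext•_{𝔊₀}(E₀′, E₀′) = Ext•_{X₀}(E₀, E₀)` for `E₀′ = π^*E₀ ⊗ L` — gs-red GS-23(a): «`π` cohomologically
affine, `π_* π^* = id` on weight `0`» AND «`- ⊗ L` an autoequivalence». This file supplies the SECOND half on
real carriers, in the generality Mathlib affords: for an (additive) EQUIVALENCE of abelian categories
`Φ : C ≌ D` with `C` having enough injectives, `Φ` induces a BIJECTION `Extⁿ(X, Y) → Extⁿ(Φ X, Φ Y)`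
(`mapExtAddHom_bijective_of_equivalence`; Mathlib `Functor.mapExt_bijective_of_preservesInjectiveObjects`
with the instances «an equivalence is exact, fully faithful and preserves injectives»). For `C = X.Modules`
(enough injectives: Grothendieck/Hartshorne III.2.2, tree instance) and `Φ` an autoequivalence — intended:
`- ⊗ M` for a line bundle `M`, in particular the untwisted reading `E′ = E₀ ⊗ M_B` of the STEP-0 component
(p1 UNTWIST-p1 (V3′); lead R-49(a)/R-51(a)), or the weight-`1` untwisting `- ⊗ L^{∓1}` between the
weight-`1` and weight-`0` blocks on the gerbe — this is the map `θ` of `UntwistFullSigma.lean`, now REAL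
(`Φ.functor.mapExtAddHom E E 2`) instead of an abstract additive bijection; `isISemiregular_iff_of_equivalence`
then transports `I`-semiregularity (every lower set `I`; FULL `σ`: `isISemiregular_univ_iff_of_equivalence`)
along `Φ` under the same triangular hypothesis on the components `σ_q` (the Leibniz rule
`At(F ⊗ M) = At(F) ⊗ 1 + 1 ⊗ c₁(M)`, Atiyah 1957 Prop. 10–11, which stays a hypothesis: the tree has no
line-bundle twist functor with unitors on `X.Modules`). NOT covered: the FIRST half of (i) — `π^*` from `X₀`
to the gerbe is fully faithful and exact but NOT an equivalence onto all modules on `𝔊₀` (only onto the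
weight-`0` block); an `Ext`-comparison for a fully faithful exact functor needs an acyclicity input
(`Literature/Algebra/Homology/ExtComparison.lean`, Bhatt–Scholze-style), not supplied here.

## Contents (everything proved; 0 named facts; no definitions)

* `additive_of_isEquivalence` — an equivalence between abelian categories is an additive functor (it
  preserves binary products; Mathlib `Functor.additive_of_preserves_binary_products`). `Functor.Additive`
  is a `Prop`, so this discharges the instance hypothesis of the next items (`haveI`).
* `mapExtAddHom_bijective_of_equivalence` — `Φ : C ≌ D`, `C` with enough injectives:
  `Φ.functor.mapExtAddHom X Y n` is bijective for all `X Y n`.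
* `isISemiregular_iff_of_equivalence`, `isISemiregular_univ_iff_of_equivalence` — on the real carriers
  `σ_q = sigmaHigher`: for an autoequivalence-type `Φ : X.Modules ≌ X′.Modules`, `E` and `Φ E` finite locally
  free, injective diagonals `d_q` and arbitrary `u_{q,j}` with
  `σ_q^{Φ E}(Φ ξ) = d_q(σ_q^E ξ) + Σ_{j<q} u_{q,j}(σ_j^E ξ)` on a lower set `I`:
  `IsISemiregular hE I ↔ IsISemiregular hΦE I`.

## References

* R. Hartshorne, *Algebraic Geometry*, III.2.2 (enough injectives in `Mod(𝒪_X)`). [Hartshorne1977]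
* R.-O. Buchweitz, H. Flenner, Compositio Math. 137 (2003), §5 (`I`-semiregular). [BuchweitzFlenner2003]
* M. F. Atiyah, Trans. AMS 85 (1957), Prop. 10–11 (the Atiyah class of a tensor product). [Atiyah1957]
-/

open CategoryTheory CategoryTheory.Abelian AlgebraicGeometry

namespace Summit.Ventures.HSemireg

/-! ### `Ext` along an equivalence of abelian categories -/

section ExtEquivalence

universe w w' v v' u u'

variable {C : Type u} [Category.{v} C] [Abelian C] {D : Type u'} [Category.{v'} D] [Abelian D]

/-- **An equivalence between abelian categories is additive** (it preserves binary products and zero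
morphisms). `Functor.Additive` is a `Prop`-valued class, so this can be installed with `haveI` wherever an
instance `[Φ.functor.Additive]` is requested. [folklore] -/
theorem additive_of_isEquivalence (F : C ⥤ D) [F.IsEquivalence] : F.Additive :=
  Functor.additive_of_preserves_binary_products F

/-- **`Ext` is invariant under an equivalence of abelian categories**: for `Φ : C ≌ D` additive (automatic,
`additive_of_isEquivalence`) and `C` with enough injectives, the induced map
`Extⁿ(X, Y) → Extⁿ(Φ X, Φ Y)` (Mathlib `Functor.mapExtAddHom`) is bijective — an equivalence is exact, fully
faithful and preserves injective objects, so Mathlib's `Functor.mapExt_bijective_of_preservesInjectiveObjects`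
applies. (The «`- ⊗ L` is an autoequivalence» half of route R1.0 (i).) [folklore] -/
theorem mapExtAddHom_bijective_of_equivalence (Φ : C ≌ D) [Φ.functor.Additive] [HasExt.{w} C]
    [HasExt.{w'} D] [EnoughInjectives C] (X Y : C) (n : ℕ) :
    Function.Bijective (Φ.functor.mapExtAddHom X Y n) :=
  Φ.functor.mapExt_bijective_of_preservesInjectiveObjects X Y n

end ExtEquivalence

/-! ### Transport of `I`-semiregularity along an equivalence of module categories -/

section Sigma

open Literature.AlgebraicGeometry.Motives Literature.AlgebraicGeometry.HodgeTheory
  Literature.AlgebraicGeometry.Modules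

universe w w' u

variable {S : Type u} [CommRing S] {X : Over (Spec (CommRingCat.of S))} [HasExt.{w} X.left.Modules]
  {S' : Type u} [CommRing S'] {X' : Over (Spec (CommRingCat.of S'))} [HasExt.{w'} X'.left.Modules]
  (Φ : X.left.Modules ≌ X'.left.Modules) [Φ.functor.Additive]
  {E : X.left.Modules} (hE : IsFiniteLocallyFree E) (hE' : IsFiniteLocallyFree (Φ.functor.obj E))

/-- **Untwisting along an equivalence preserves `I`-semiregularity for every lower set `I`.** Let
`Φ : Mod(𝒪_X) ≌ Mod(𝒪_{X′})` be an (additive) equivalence — intended: `- ⊗ M`, `M` a line bundle (the untwisted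
reading `E′ = E₀ ⊗ M_B`), or the untwisting `- ⊗ L^{∓1}` by the tautological root on the `μ₂`-gerbe — with `E`
and `Φ E` finite locally free, and suppose the components transform triangularly with injective diagonal:
`σ_q^{Φ E}(Φ ξ) = d_q (σ_q^E ξ) + Σ_{j<q} u_{q,j} (σ_j^E ξ)` for `q ∈ I` (the Leibniz rule for `At(E ⊗ M)`, a
hypothesis). Then `E` is `I`-semiregular iff `Φ E` is: the comparison `θ = Φ.functor.mapExtAddHom E E 2` is a
REAL additive bijection by `mapExtAddHom_bijective_of_equivalence` (enough injectives in `Mod(𝒪_X)`: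
Hartshorne III.2.2, tree instance), and `UntwistFullSigma.isISemiregular_iff_of_triangular` applies.
[cite: BuchweitzFlenner2003, §5 (I-semiregular)] -/
theorem isISemiregular_iff_of_equivalence
    (d : ∀ q, hodgeCohomology X q (q + 2) →+ hodgeCohomology X' q (q + 2))
    (u : ∀ q j, hodgeCohomology X j (j + 2) →+ hodgeCohomology X' q (q + 2))
    {I : Set ℕ} (hI : IsLowerSet I) (hd : ∀ q ∈ I, Function.Injective (d q))
    (hσ : ∀ q ∈ I, ∀ x : Ext.{w} E E 2, sigmaHigher hE' q (Φ.functor.mapExtAddHom E E 2 x) =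
      d q (sigmaHigher hE q x) + ∑ j ∈ Finset.range q, u q j (sigmaHigher hE j x)) :
    IsISemiregular.{w} hE I ↔ IsISemiregular.{w'} hE' I :=
  isISemiregular_iff_of_triangular hE hE'
    (AddEquiv.ofBijective (Φ.functor.mapExtAddHom E E 2) (mapExtAddHom_bijective_of_equivalence Φ E E 2))
    d u hI hd fun q hq x => by rw [AddEquiv.ofBijective_apply]; exact hσ q hq x

/-- **FULL semiregularity is invariant under untwisting along an equivalence** (`I = Set.univ`; the R1.0
clause «`σ_{E₀′}` injective iff `σ_{E₀}` is», with the `Ext²` identification realised by the equivalence).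
[cite: BuchweitzFlenner2003, Def. 4.1 and §5] -/
theorem isISemiregular_univ_iff_of_equivalence
    (d : ∀ q, hodgeCohomology X q (q + 2) →+ hodgeCohomology X' q (q + 2))
    (u : ∀ q j, hodgeCohomology X j (j + 2) →+ hodgeCohomology X' q (q + 2))
    (hd : ∀ q, Function.Injective (d q))
    (hσ : ∀ (q : ℕ) (x : Ext.{w} E E 2), sigmaHigher hE' q (Φ.functor.mapExtAddHom E E 2 x) =
      d q (sigmaHigher hE q x) + ∑ j ∈ Finset.range q, u q j (sigmaHigher hE j x)) :
    IsISemiregular.{w} hE Set.univ ↔ IsISemiregular.{w'} hE' Set.univ :=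
  isISemiregular_iff_of_equivalence Φ hE hE' d u isLowerSet_univ (fun q _ => hd q) fun q _ => hσ q

end Sigma

end Summit.Ventures.HSemireg
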